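import Mathlib
import HarnessLib

/-!
# Route `PoloidalWindowDoor`, crux `PoloidalWindowRigidity` (stmt-NavierStokesRegularity-19708) — LINE 20 «hot_forest»
# (ns-idea-8 g10, v1.2): the TOPOLOGICAL CORE of F3 `CapturedEndConverges` (Mathlib only)

Seat ns-es-p1 g7 (free prover hand; CLAIM announced on the ideators / ns-regularity-ideate buses before proposing).  No
Navier–Stokes content: the topology of «a captured end of an injective hot vortex line converges», from the local branch
structure of the planar zero set (the line's V1 `PlanarZeroBranches`, consumed as a hypothesis by the assembly file).

* `captured_core` — a continuous injective curve avoiding `q`, whose points near `q` lie on finitely many distance-parametrised,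
  pairwise disjoint continuous half-branches at `q`, and which has `q` as a cluster value at `+∞`, tends to `q` at `+∞`.
  Proof: the branch index is locally constant on the open set `{dist(γ,q) < r}` (finite disjoint cover ⇒ open partition,
  `IsPreconnected.subset_or_subset`), so the distance is injective hence strictly monotone on every interval inside
  (`ContinuousOn.strictMonoOn_of_injOn_Icc'`); between two exits a strict interior minimum is impossible, so after the last exit
  (`sSup`/`sInf` of the closed exit sets) the distance decreases below every `ε`.

HONEST LABEL: a topology lemma; nothing about any crux, route item or Navier–Stokes regularity is proved here (all OPEN).
-/

noncomputable section

-- the summit and its single sub-problem share the name (CONVENTIONS §1), as in every Theorems file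
set_option linter.dupNamespace false

namespace Summit.NavierStokesRegularity.NavierStokesRegularity.Theorems.PoloidalWindowDoorPoloidalWindowRigidityHotForestCapturedCore

open Set Function Filter Topology Metric

variable {E : Type*} [MetricSpace E]

/-- **Core of F3 (topology of a captured end).**  A continuous injective curve `γ : ℝ → E` avoiding `q`, whose points within
distance `r` of `q` all lie on finitely many continuous half-branches `β i : [0,1) → E` emanating from `q`, parametrised by
distance (`dist (β i s) q = r s`) and pairwise disjoint off `q`: if `q` is a cluster value of `γ` at `+∞`, then `γ → q` at `+∞`.
Proof: the branch index is locally constant on the open set `{τ | dist (γ τ) q < r}` (finite disjoint cover by relatively closed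
sets), so `τ ↦ dist (γ τ) q` is injective — hence strictly monotone — on every interval inside that set; a strict interior
minimum of the distance between two exits is then impossible, and after the last exit the distance decreases to `0`. [folklore] -/
theorem captured_core {γ : ℝ → E} {q : E} {r : ℝ} {m : ℕ} {β : Fin m → ℝ → E}
    (hγc : Continuous γ) (hγi : Injective γ) (hγq : ∀ τ, γ τ ≠ q) (hr : 0 < r)
    (hβc : ∀ i, ContinuousOn (β i) (Ico 0 1))
    (hβd : ∀ i, ∀ s ∈ Ico (0 : ℝ) 1, dist (β i s) q = r * s)
    (hβinj : ∀ i j, ∀ s ∈ Ioo (0 : ℝ) 1, β i s = β j s → i = j)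
    (hcover : ∀ τ, dist (γ τ) q < r → ∃ i, ∃ s ∈ Ioo (0 : ℝ) 1, γ τ = β i s)
    (hclus : MapClusterPt q atTop γ) :
    Tendsto γ atTop (𝓝 q) := by
  -- the distance function
  set d : ℝ → ℝ := fun τ => dist (γ τ) q with hd
  have hdc : Continuous d := (continuous_id.dist continuous_const).comp hγc |>.congr (fun _ => rfl)
  have hdpos : ∀ τ, 0 < d τ := fun τ => dist_pos.2 (hγq τ)
  -- points within `r` sit on a branch at parameter `d τ / r`
  have hrepr : ∀ τ, d τ < r → ∃ i, γ τ = β i (d τ / r) := by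
    intro τ hτ
    obtain ⟨i, s, hs, hγs⟩ := hcover τ hτ
    have hds : d τ = r * s := by rw [hd]; simp only; rw [hγs]; exact hβd i s ⟨hs.1.le, hs.2⟩
    refine ⟨i, ?_⟩
    rw [hγs, hds, mul_div_cancel_left₀ _ hr.ne']
  have hsI : ∀ τ, d τ < r → d τ / r ∈ Ioo (0 : ℝ) 1 := fun τ hτ =>
    ⟨div_pos (hdpos τ) hr, (div_lt_one hr).2 hτ⟩
  -- the branch sets `K i` and their openness
  set S : Set ℝ := {τ | d τ < r} with hS
  have hSo : IsOpen S := isOpen_lt hdc continuous_const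
  set K : Fin m → Set ℝ := fun i => {τ | d τ < r ∧ γ τ = β i (d τ / r)} with hK
  have hKcover : ∀ τ, d τ < r → ∃ i, τ ∈ K i := fun τ hτ => by
    obtain ⟨i, hi⟩ := hrepr τ hτ; exact ⟨i, hτ, hi⟩
  have hKdisj : ∀ i j τ, τ ∈ K i → τ ∈ K j → i = j := fun i j τ hi hj =>
    hβinj i j _ (hsI τ hi.1) (hi.2.symm.trans hj.2)
  have hVo : ∀ j, IsOpen {τ | d τ < r ∧ γ τ ≠ β j (d τ / r)} := by
    intro j
    have hf : ContinuousOn (fun τ => (γ τ, β j (d τ / r))) S := by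
      refine hγc.continuousOn.prodMk ?_
      refine (hβc j).comp (hdc.div_const r).continuousOn fun τ hτ => ?_
      exact ⟨(hsI τ hτ).1.le, (hsI τ hτ).2⟩
    have h := hf.isOpen_inter_preimage hSo isClosed_diagonal.isOpen_compl
    have heq : {τ | d τ < r ∧ γ τ ≠ β j (d τ / r)} = S ∩ (fun τ => (γ τ, β j (d τ / r))) ⁻¹' (diagonal E)ᶜ := by
      ext τ; simp [hS, Set.mem_diagonal_iff]
    rw [heq]; exact h
  have hKo : ∀ i, IsOpen (K i) := by
    intro i
    have heq : K i = S ∩ ⋂ j ∈ (Finset.univ.erase i : Finset (Fin m)), {τ | d τ < r ∧ γ τ ≠ β j (d τ / r)} := by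
      ext τ
      simp only [hK, hS, mem_setOf_eq, mem_inter_iff, mem_iInter, Finset.mem_erase, Finset.mem_univ, and_true]
      constructor
      · rintro ⟨hτ, hγτ⟩
        refine ⟨hτ, fun j hj => ⟨hτ, fun hj' => hj (hKdisj j i τ ⟨hτ, hj'⟩ ⟨hτ, hγτ⟩)⟩⟩
      · rintro ⟨hτ, hall⟩
        obtain ⟨j, hj⟩ := hKcover τ hτ
        by_cases hji : j = i
        · exact hji ▸ hj
        · exact absurd hj.2 (hall j hji).2
    rw [heq]
    exact hSo.inter (isOpen_biInter_finset fun j _ => hVo j)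
  -- on a preconnected subset of `S` the branch index is constant
  have hconst : ∀ (I : Set ℝ), IsPreconnected I → I ⊆ S → ∀ τ₀ ∈ I, ∀ i, τ₀ ∈ K i → I ⊆ K i := by
    intro I hI hIS τ₀ hτ₀ i hi
    have hu : IsOpen (⋃ j ∈ (Finset.univ.erase i : Finset (Fin m)), K j) :=
      isOpen_biUnion fun j _ => hKo j
    have hdisj : Disjoint (K i) (⋃ j ∈ (Finset.univ.erase i : Finset (Fin m)), K j) := by
      rw [Set.disjoint_left]
      intro τ hτ hτ'
      simp only [mem_iUnion, Finset.mem_erase, Finset.mem_univ, and_true, exists_prop] at hτ'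
      obtain ⟨j, hj, hτj⟩ := hτ'
      exact hj (hKdisj j i τ hτj hτ)
    have hcov : I ⊆ K i ∪ ⋃ j ∈ (Finset.univ.erase i : Finset (Fin m)), K j := by
      intro τ hτ
      obtain ⟨j, hj⟩ := hKcover τ (hIS hτ)
      by_cases hji : j = i
      · exact Or.inl (hji ▸ hj)
      · refine Or.inr ?_
        simp only [mem_iUnion, Finset.mem_erase, Finset.mem_univ, and_true, exists_prop]
        exact ⟨j, hji, hj⟩
    rcases hI.subset_or_subset (hKo i) hu hdisj hcov with h | h
    · exact h
    · exact absurd (h hτ₀) (Set.disjoint_left.1 hdisj hi)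
  -- hence `d` is injective on every closed interval inside `S`, so strictly monotone or antitone
  have hinj : ∀ a b : ℝ, Icc a b ⊆ S → InjOn d (Icc a b) := by
    intro a b hab τ₁ hτ₁ τ₂ hτ₂ heq
    rcases le_or_gt a b with hle | hgt
    · obtain ⟨i, hi⟩ := hKcover a (hab (left_mem_Icc.2 hle))
      have hall := hconst (Icc a b) isPreconnected_Icc hab a (left_mem_Icc.2 hle) i hi
      have h1 := (hall hτ₁).2
      have h2 := (hall hτ₂).2
      apply hγi
      rw [h1, h2, show d τ₁ = d τ₂ from heq]
    · exact absurd (hτ₁.1.trans hτ₁.2) (not_le.2 hgt)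
  have hmono : ∀ a b : ℝ, a ≤ b → Icc a b ⊆ S → StrictMonoOn d (Icc a b) ∨ StrictAntiOn d (Icc a b) :=
    fun a b hab hS' => hdc.continuousOn.strictMonoOn_of_injOn_Icc' hab (hinj a b hS')
  -- no strict interior minimum between two points of an interval inside `S`
  have hnomin : ∀ a t b : ℝ, a < t → t < b → Icc a b ⊆ S → d t < d a → d t < d b → False := by
    intro a t b hat htb hS' hta htb'
    rcases hmono a b (hat.trans htb).le hS' with h | h
    · exact absurd (h ⟨le_rfl, (hat.trans htb).le⟩ ⟨hat.le, htb.le⟩ hat) (not_lt.2 hta.le)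
    · exact absurd (h ⟨hat.le, htb.le⟩ ⟨(hat.trans htb).le, le_rfl⟩ htb) (not_lt.2 htb'.le)
  -- the cluster hypothesis in metric form
  have hfreq : ∀ ε > 0, ∀ T : ℝ, ∃ τ ≥ T, d τ < ε := by
    intro ε hε T
    have h := (mapClusterPt_iff_frequently.1 hclus) (Metric.ball q ε) (Metric.ball_mem_nhds q hε)
    obtain ⟨τ, hτT, hτ⟩ := (frequently_atTop.1 h) T
    exact ⟨τ, hτT, hτ⟩
  -- after a time from which `γ` stays within `r`, the distance is eventually below `ε`
  have htail : ∀ ε > 0, ∀ T : ℝ, (∀ τ ≥ T, d τ < r) → d T < ε → ∀ τ ≥ T, d τ < ε := by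
    intro ε hε T hT hTε τ hτ
    obtain ⟨τ₂, hτ₂, hdτ₂⟩ := hfreq (d T) (hdpos T) (max τ T + 1)
    have hTτ₂ : T < τ₂ := by linarith [le_max_right τ T]
    have hsub : Icc T τ₂ ⊆ S := fun σ hσ => hT σ hσ.1
    rcases hmono T τ₂ hTτ₂.le hsub with h | h
    · exact absurd (h ⟨le_rfl, hTτ₂.le⟩ ⟨hTτ₂.le, le_rfl⟩ hTτ₂) (not_lt.2 hdτ₂.le)
    · have hττ₂ : τ ≤ τ₂ := by linarith [le_max_left τ T]
      rcases eq_or_lt_of_le hτ with h' | h'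
      · rw [← h']; exact hTε
      · exact (h ⟨le_rfl, hTτ₂.le⟩ ⟨hτ, hττ₂⟩ h').trans hTε
  -- conclusion
  rw [Metric.tendsto_atTop]
  intro ε hε
  set ε' : ℝ := min ε (r / 2) with hε'
  have hε'0 : 0 < ε' := lt_min hε (by positivity)
  have hε'r : ε' < r := (min_le_right _ _).trans_lt (by linarith)
  have hε'ε : ε' ≤ ε := min_le_left _ _
  suffices h : ∃ T, ∀ τ ≥ T, d τ < ε' by
    obtain ⟨T, hT⟩ := h
    exact ⟨T, fun τ hτ => (hT τ hτ).trans_le hε'ε⟩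
  obtain ⟨τ₀, -, hτ₀⟩ := hfreq ε' hε'0 0
  by_cases hA : ∀ τ ≥ τ₀, d τ < r
  · exact ⟨τ₀, htail ε' hε'0 τ₀ hA hτ₀⟩
  · simp only [not_forall, not_lt] at hA
    obtain ⟨τb, hτb, hdτb⟩ := hA
    obtain ⟨τ₁, hτ₁, hdτ₁⟩ := hfreq ε' hε'0 (τb + 1)
    -- the last exit before `τ₁`
    set A : Set ℝ := {τ | τ ≤ τ₁ ∧ r ≤ d τ} with hAset
    have hAne : A.Nonempty := ⟨τb, by linarith, hdτb⟩
    have hAbdd : BddAbove A := ⟨τ₁, fun τ hτ => hτ.1⟩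
    have hAcl : IsClosed A := (isClosed_le continuous_id continuous_const).inter (isClosed_le continuous_const hdc)
    have ha₁A : sSup A ∈ A := hAcl.csSup_mem hAne hAbdd
    set a₁ := sSup A with ha₁
    have ha₁τ₁ : a₁ < τ₁ := lt_of_le_of_ne ha₁A.1 fun h => by
      have := ha₁A.2; rw [h] at this; linarith
    have hafter : ∀ τ, a₁ < τ → τ ≤ τ₁ → d τ < r := by
      intro τ h1 h2
      by_contra hge
      exact not_le.2 h1 (le_csSup hAbdd ⟨h2, not_lt.1 hge⟩)
    -- no exit after `τ₁`
    have hB : ∀ τ ≥ τ₁, d τ < r := by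
      intro τ hτ
      by_contra hge
      rw [not_lt] at hge
      set B : Set ℝ := {σ | τ₁ ≤ σ ∧ r ≤ d σ} with hBset
      have hBne : B.Nonempty := ⟨τ, hτ, hge⟩
      have hBbdd : BddBelow B := ⟨τ₁, fun σ hσ => hσ.1⟩
      have hBcl : IsClosed B := (isClosed_le continuous_const continuous_id).inter (isClosed_le continuous_const hdc)
      have hb₁B : sInf B ∈ B := hBcl.csInf_mem hBne hBbdd
      set b₁ := sInf B with hb₁
      have hτ₁b₁ : τ₁ < b₁ := lt_of_le_of_ne hb₁B.1 fun h => by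
        have := hb₁B.2; rw [← h] at this; linarith
      have hbefore : ∀ σ, τ₁ ≤ σ → σ < b₁ → d σ < r := by
        intro σ h1 h2
        by_contra hge'
        exact not_le.2 h2 (csInf_le hBbdd ⟨h1, not_lt.1 hge'⟩)
      -- points just inside the exits where `d > ε'`
      obtain ⟨a', ha'1, ha'2, hda'⟩ : ∃ a', a₁ < a' ∧ a' < τ₁ ∧ ε' < d a' := by
        have hev : ∀ᶠ σ in 𝓝 a₁, ε' < d σ :=
          (hdc.continuousAt (x := a₁)).eventually (lt_mem_nhds (hε'r.trans_le ha₁A.2))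
        obtain ⟨η, hη, hη'⟩ := Metric.eventually_nhds_iff.1 hev
        refine ⟨a₁ + min (η / 2) ((τ₁ - a₁) / 2), ?_, ?_, hη' ?_⟩
        · have : 0 < min (η / 2) ((τ₁ - a₁) / 2) := lt_min (by linarith) (by linarith); linarith
        · have : min (η / 2) ((τ₁ - a₁) / 2) ≤ (τ₁ - a₁) / 2 := min_le_right _ _; linarith
        · rw [Real.dist_eq, show a₁ + min (η / 2) ((τ₁ - a₁) / 2) - a₁ = min (η / 2) ((τ₁ - a₁) / 2) by ring,
            abs_of_pos (lt_min (by linarith) (by linarith))]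
          exact (min_le_left _ _).trans_lt (by linarith)
      obtain ⟨b', hb'1, hb'2, hdb'⟩ : ∃ b', τ₁ < b' ∧ b' < b₁ ∧ ε' < d b' := by
        have hev : ∀ᶠ σ in 𝓝 b₁, ε' < d σ :=
          (hdc.continuousAt (x := b₁)).eventually (lt_mem_nhds (hε'r.trans_le hb₁B.2))
        obtain ⟨η, hη, hη'⟩ := Metric.eventually_nhds_iff.1 hev
        refine ⟨b₁ - min (η / 2) ((b₁ - τ₁) / 2), ?_, ?_, hη' ?_⟩
        · have : min (η / 2) ((b₁ - τ₁) / 2) ≤ (b₁ - τ₁) / 2 := min_le_right _ _; linarith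
        · have : 0 < min (η / 2) ((b₁ - τ₁) / 2) := lt_min (by linarith) (by linarith); linarith
        · rw [Real.dist_eq, show b₁ - min (η / 2) ((b₁ - τ₁) / 2) - b₁ = -min (η / 2) ((b₁ - τ₁) / 2) by ring,
            abs_neg, abs_of_pos (lt_min (by linarith) (by linarith))]
          exact (min_le_left _ _).trans_lt (by linarith)
      have hsub : Icc a' b' ⊆ S := by
        intro σ hσ
        rcases le_or_gt σ τ₁ with h | h
        · exact hafter σ (ha'1.trans_le hσ.1) h
        · exact hbefore σ h.le (hσ.2.trans_lt hb'2)
      exact hnomin a' τ₁ b' ha'2 hb'1 hsub (hdτ₁.trans hda') (hdτ₁.trans hdb')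
    exact ⟨τ₁, htail ε' hε'0 τ₁ hB hdτ₁⟩

end Summit.NavierStokesRegularity.NavierStokesRegularity.Theorems.PoloidalWindowDoorPoloidalWindowRigidityHotForestCapturedCore

end
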